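/-
Copyright (c) 2026 the pub-hodgecm-mathlib formalisation cell (harness21).  Prover seat hodgecm-mathlib-K2Liu-p03 (g8), Track B «K2-LIT»,
#184♮ = hLiu418 = `stmt-HodgeConjecture-24832`; socket #41, KIND 1 — (K1a-T) brick (C-b): THE CORNER DATA OF RECORD WITH ITS RANK-ONE PRESENTATION EXPORTED
(Levi chart `Λ` and row section `γ` BY VALUE; `↑S = u ⊗ w`, the translate IS `Λ(γ[w])`, the diagonal identities `t_k·S_kk = N(γ[w]_{1k})·t₁·σc`, `τ(σc) ≠ 0`, the transport)
— the transparency the (L4)∕(L5) count letters of ★ p863488 need about ★ p863692 §2's `∃`-bound `σc gc` (K1a desk K2E5-p16 (g8) 01:10:41Z; this seat 01:20Z).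
THEOREMS ONLY (no `def`, no `instance`, no notation, no named-fact hypothesis, no `sorry`).
-/
import Summits.HodgeConjecture.HodgeConjecture.Theorems.K2LiuKindOneSingularTailEuler   -- ★ p863692 FILE 1 (this seat): `mul_trace_mul_imagUnit_ne_zero` (+ ★ (K1a-1), ★ (V-b), ★ α2c, ★ `K2LiuRankOneTwoByTwo`)
import HarnessLib

/-!
# Crux `HLiu418`, socket #41 KIND 1 a♮ — (K1a-T)(C-b) `K2LiuKindOneSingularCornerPresentation`: THE CORNER VALUE `σc(S)` WITH ITS PRESENTATION LETTERS, FOR A GIVEN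
# LEVI CHART `Λ` AND ROW SECTION `γ`: `↑S = u_S ⊗ w_S`, `t_k·S_kk = c(γ[w_S]_{1k})·t₁·σc(S)·γ[w_S]_{1k}`, `t₁·Tr(σc(S)δ) ≠ 0`, `W_S(f)(h) = W_{σc(S)E₁₁}(f)(Λ(γ[w_S])·h)`

Cell `hodgecm-mathlib`, crux item hLiu418 = `stmt-HodgeConjecture-24832` (helper lane `--supports … --as helper`, count-neutral), route of record `HCCMUnconditional`;
squad K2 ∕ K2Liu, road `K2_Liu`, socket #41, KIND 1, block K1-a♮.

WHY.  ★ p863692 §2 `exists_cornerData_of_record` hides the Levi chart, the row section and the rank-one presentation behind `∃ σc gc`; the count letters of the (dec) road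
((L4) ★ p864035 `hGb_of_countLetter`'s `hPm`, in the `D`-currency) must bound `#{v : (gc S·h)_v ∉ K_v}` and `ω(den τ(σc S))` in terms of a common denominator `D` of `S`,
which needs: the translate IS `Λ(γ[w_S])` for a row section `γ` whose height is controlled (★ (ρ6a) `hΛγ_of_heightBricks` ∕ ★ `exists_leviRow_translate_height_le` take `Λ, γ`
BY VALUE), and `σc(S)` IS a diagonal entry of `S` up to the fixed scalars `t_k∕t₁` and a norm `N(γ[w_S]_{1k})` (so `den τ ∣ den(D·S)·d₀`).  THIS FILE re-runs ★ FILE 1 §2's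
construction with `Λ` (★ `exists_leviHom_blk_eq`'s block law `hΛ`) and `γ` (section property `hγ`) as INPUTS and exports those letters:
* **`exists_cornerPresentation_of_record`** — `∃ σc u w (hw : ∀ S, w S ≠ 0)` such that for every rank-one `T_L`-skew `S` (`↑S ≠ 0`, `det ↑S = 0`), with `g := γ[w S]`:
  (i) `↑S = vecMulVec (u S) (w S)` (★ `exists_vecMulVec_of_det_eq_zero`); (ii) for BOTH `k : Fin 2`, `T_L k k · S k k = c(g 1 k) · T_L 1 1 · σc S · g 1 k` (★ p862643's corner
  equation + Levi relation read on the diagonal: ★ `gramRL_mul_apply`, ★ `conj_single_apply_same`); (iii) `t₁·Tr_{L∕L⁺}(σc(S)·δ) ≠ 0` (★ `mul_trace_mul_imagUnit_ne_zero` ∘ ★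
  `corner_eq_val₂_mul_norm` + ★ `hval₂`); (iv) for every Haar `νN`, every `χ`, `s` and Siegel section `f ∈ I_Δ(s,χ)`, every `h`:
  `W_S(f)(h) = W_{σc(S) E₁₁}(f)(Λ(map g) · h)` (★ `whittakerDelta_eq_whittakerDelta_conj_index` + ★ `measurePreserving_conj_levi`).
HONEST LABEL.  Count-neutral helper (★ FILE 1 §2 re-addressed for transparency; no new mathematics); it closes no socket: `HC_CM` is proved only modulo the 7 printed
citations (2 remaining named inputs: hLiu418 = `stmt-HodgeConjecture-24832`, h413 = `stmt-HodgeConjecture-24833`) until rung 0 closes.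

## References
* [KudlaRallis1994] S. Kudla, S. Rallis, *A regularized Siegel–Weil formula: the first term identity*, Ann. of Math. 140 (1994): §2 (2.10)–(2.12).
* [MoeglinWaldspurger1995] C. Mœglin, J.-L. Waldspurger, *Spectral Decomposition and Eisenstein Series* (1995): II.1.7.
* [Shimura1997] G. Shimura, *Euler Products and Eisenstein Series*, CBMS 93 (1997): §18.1, §18.3–18.4.
-/

set_option autoImplicit false
-- the mandated namespace repeats the single-problem summit's segment (`HodgeConjecture.HodgeConjecture`)
set_option linter.dupNamespace false

noncomputable section

open scoped Matrix ENNReal NNReal ComplexConjugate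
open NumberField IsDedekindDomain MeasureTheory Measure Filter Set

namespace Summit.HodgeConjecture.HodgeConjecture.Cruxes.HLiu418.K2LiuKindOneSingularCornerPresentation

open Literature.NumberTheory.Automorphic Literature.NumberTheory.Automorphic.UnitaryGroup Literature.NumberTheory.GaloisRepresentations
open Literature.NumberTheory.GelbartRogawski1991 Literature.NumberTheory.GelbartRogawski1991.GRConstruction
open Literature.NumberTheory.GelbartRogawski1991.AdaptedBlocks
open Literature.NumberTheory.GelbartRogawski1991.UnitaryDualPair
open Literature.NumberTheory.K2Lit.SiegelDoubled
open Summit.HodgeConjecture.HodgeConjecture.Cruxes.HLiu418.K2LiuSiegelUnipotentLocalDefs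
open Summit.HodgeConjecture.HodgeConjecture.Cruxes.HLiu418.K2LiuSiegelUnipotentFourierDefs
open Summit.HodgeConjecture.HodgeConjecture.Cruxes.HLiu418.K2LiuSiegelMiddleCellLeviCriterion (row_ne_zero)
open Summit.HodgeConjecture.HodgeConjecture.Cruxes.HLiu418.K2LiuRankOneCornerIndexTransport
  (exists_rat_levi_blocks_levi_map conj_index_eq_single whittakerDelta_eq_whittakerDelta_conj_index)
open Summit.HodgeConjecture.HodgeConjecture.Cruxes.HLiu418.K2LiuRankOneIndexValueTwoCorner
  (corner_eq_val₂_mul_norm hval₂ gramR_apply_same_ne_zero gramRL_mul_apply conj_single_apply_same)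
open Summit.HodgeConjecture.HodgeConjecture.Cruxes.HLiu418.K2LiuUnipDeltaConjMeasurePreserving (measurePreserving_conj_levi)
open Summit.HodgeConjecture.HodgeConjecture.Cruxes.HLiu418.K2LiuRankOneTwoByTwo (exists_vecMulVec_of_det_eq_zero)
open Summit.HodgeConjecture.HodgeConjecture.Cruxes.HLiu418.K2LiuKindOneSingularTailEuler (mul_trace_mul_imagUnit_ne_zero)

variable (L : Type) [Field L] [NumberField L] [IsCMField L]
variable {N M : ℕ} (e : Fin N × Fin M ≃ Fin 2)
  (dV : Fin N → L) (hdV : ∀ i, IsCMField.complexConj L (dV i) = dV i)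
  (dW : Fin M → L) (hdW : ∀ i, IsCMField.complexConj L (dW i) = dW i)

/-- **(C-b) THE CORNER VALUE OF RECORD WITH ITS PRESENTATION LETTERS, for a given Levi chart `Λ` and row section `γ`.**  Inputs: `dV dW` non-zero; a Levi chart
`Λ : GL₂(𝔸_L) →* H(𝔸)` with ★ α3-2's block law (`hΛ`, ★ `exists_leviHom_blk_eq`); a section `γ : ℙ(L²) → GL₂(L)` of the second row (`hγ`; e.g. ★ `exists_normalised_rowSection`'s,
whose height ★ (ρ6a) controls).  OUTPUT: `∃ σc u w (hw : ∀ S, w S ≠ 0)` with, for every rank-one `T_L`-skew `S` and `g := γ[w S]`: (i) `↑S = vecMulVec (u S) (w S)`;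
(ii) `∀ k, T_L k k · S k k = c(g 1 k)·T_L 1 1·σc S·g 1 k`; (iii) `t₁·Tr_{L∕L⁺}(σc(S)δ) ≠ 0`; (iv) `W_S(f)(h) = W_{σc(S)E₁₁}(f)(Λ(map g)·h)` for every Haar `νN` ∕ `χ` ∕ `s` ∕ Siegel
section `f` ∕ `h`. [cite: KudlaRallis1994, §2 (2.10)–(2.12)] [cite: MoeglinWaldspurger1995, II.1.7] [cite: Shimura1997, §18.3–18.4] -/
theorem exists_cornerPresentation_of_record (hdV0 : ∀ i, dV i ≠ 0) (hdW0 : ∀ i, dW i ≠ 0)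
    [MeasurableSpace ↥(unipDelta L e dV hdV dW hdW)] [BorelSpace ↥(unipDelta L e dV hdV dW hdW)]
    (Λ : GL (Fin 2) (AdeleRing (𝓞 L) L) →* HA L e dV hdV dW hdW)
    (hΛ : ∀ g : GL (Fin 2) (AdeleRing (𝓞 L) L), blk L e dV hdV dW hdW (Λ g) =
      cayR (AdeleRing (𝓞 L) L) (Fin 2) * Matrix.fromBlocks (g : Matrix (Fin 2) (Fin 2) (AdeleRing (𝓞 L) L)) 0 0
        (((gramR L e dV hdV dW hdW).map ((algebraMap L (AdeleRing (𝓞 L) L)).comp (algebraMap (Fp L) L)))⁻¹ *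
          (((g⁻¹ : GL (Fin 2) (AdeleRing (𝓞 L) L)) : Matrix (Fin 2) (Fin 2) (AdeleRing (𝓞 L) L)).map
            (conjAdele (Fp L) L (IsCMField.complexConj L)))ᵀ *
          (gramR L e dV hdV dW hdW).map ((algebraMap L (AdeleRing (𝓞 L) L)).comp (algebraMap (Fp L) L))) *
        cayRinv (AdeleRing (𝓞 L) L) (Fin 2))
    (γ : Projectivization L (Fin 2 → L) → GL (Fin 2) L)
    (hγ : ∀ p, Projectivization.mk L ((γ p : Matrix (Fin 2) (Fin 2) L) 1) (row_ne_zero (γ p) 1) = p) :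
    ∃ (σc : skewMatrices ((IsCMField.complexConj L : L ≃ₐ[Fp L] L) : L →+* L) ((gramR L e dV hdV dW hdW).map (algebraMap (Fp L) L)) → L)
      (u w : skewMatrices ((IsCMField.complexConj L : L ≃ₐ[Fp L] L) : L →+* L) ((gramR L e dV hdV dW hdW).map (algebraMap (Fp L) L)) → Fin 2 → L)
      (hw : ∀ S, w S ≠ 0),
      ∀ S : skewMatrices ((IsCMField.complexConj L : L ≃ₐ[Fp L] L) : L →+* L) ((gramR L e dV hdV dW hdW).map (algebraMap (Fp L) L)),
        (S : Matrix (Fin 2) (Fin 2) L) ≠ 0 → (S : Matrix (Fin 2) (Fin 2) L).det = 0 →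
          (S : Matrix (Fin 2) (Fin 2) L) = Matrix.vecMulVec (u S) (w S) ∧
          (∀ k : Fin 2, ((gramR L e dV hdV dW hdW).map (algebraMap (Fp L) L)) k k * (S : Matrix (Fin 2) (Fin 2) L) k k =
            IsCMField.complexConj L (((γ (Projectivization.mk L (w S) (hw S)) : GL (Fin 2) L) : Matrix (Fin 2) (Fin 2) L) 1 k) *
              ((gramR L e dV hdV dW hdW).map (algebraMap (Fp L) L)) 1 1 * σc S * ((γ (Projectivization.mk L (w S) (hw S)) : GL (Fin 2) L) : Matrix (Fin 2) (Fin 2) L) 1 k) ∧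
          gramR L e dV hdV dW hdW 1 1 * Algebra.trace (Fp L) L (σc S * imagUnit L) ≠ 0 ∧
          ∀ (νN : Measure ↥(unipDelta L e dV hdV dW hdW)) [νN.IsHaarMeasure] (χ : HeckeCharacter L) (s : ℂ) (f : HA L e dV hdV dW hdW → ℂ),
            IsSiegelDeltaSection L e dV hdV dW hdW χ s f → ∀ h : HA L e dV hdV dW hdW,
              whittakerDelta L e dV hdV dW hdW νN (S : Matrix (Fin 2) (Fin 2) L) f h =
                whittakerDelta L e dV hdV dW hdW νN (Matrix.single 1 1 (σc S)) f
                  (Λ (Matrix.GeneralLinearGroup.map (algebraMap L (AdeleRing (𝓞 L) L)) (γ (Projectivization.mk L (w S) (hw S)))) * h) := by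
  classical
  have key : ∀ S : skewMatrices ((IsCMField.complexConj L : L ≃ₐ[Fp L] L) : L →+* L) ((gramR L e dV hdV dW hdW).map (algebraMap (Fp L) L)),
      ∃ (σ : L) (u w : Fin 2 → L) (hw : w ≠ 0), (S : Matrix (Fin 2) (Fin 2) L) ≠ 0 → (S : Matrix (Fin 2) (Fin 2) L).det = 0 →
        (S : Matrix (Fin 2) (Fin 2) L) = Matrix.vecMulVec u w ∧
        (∀ k : Fin 2, ((gramR L e dV hdV dW hdW).map (algebraMap (Fp L) L)) k k * (S : Matrix (Fin 2) (Fin 2) L) k k =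
          IsCMField.complexConj L (((γ (Projectivization.mk L w hw) : GL (Fin 2) L) : Matrix (Fin 2) (Fin 2) L) 1 k) *
            ((gramR L e dV hdV dW hdW).map (algebraMap (Fp L) L)) 1 1 * σ * ((γ (Projectivization.mk L w hw) : GL (Fin 2) L) : Matrix (Fin 2) (Fin 2) L) 1 k) ∧
        gramR L e dV hdV dW hdW 1 1 * Algebra.trace (Fp L) L (σ * imagUnit L) ≠ 0 ∧
        ∀ (νN : Measure ↥(unipDelta L e dV hdV dW hdW)) [νN.IsHaarMeasure] (χ : HeckeCharacter L) (s : ℂ) (f : HA L e dV hdV dW hdW → ℂ),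
          IsSiegelDeltaSection L e dV hdV dW hdW χ s f → ∀ h : HA L e dV hdV dW hdW,
            whittakerDelta L e dV hdV dW hdW νN (S : Matrix (Fin 2) (Fin 2) L) f h =
              whittakerDelta L e dV hdV dW hdW νN (Matrix.single 1 1 σ) f
                (Λ (Matrix.GeneralLinearGroup.map (algebraMap L (AdeleRing (𝓞 L) L)) (γ (Projectivization.mk L w hw))) * h) := by
    intro S
    by_cases hr : (S : Matrix (Fin 2) (Fin 2) L) ≠ 0 ∧ (S : Matrix (Fin 2) (Fin 2) L).det = 0
    · obtain ⟨u, w, hu, hw, hS1⟩ := exists_vecMulVec_of_det_eq_zero hr.1 hr.2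
      obtain ⟨ha, D₀, hd, hrel, hD₀⟩ := exists_rat_levi_blocks_levi_map Λ hΛ hdV0 hdW0 (γ (Projectivization.mk L w hw))
      obtain ⟨hsingle, hσ0⟩ := conj_index_eq_single Λ hΛ hdV0 hdW0 S.2 hS1 hu hw γ hγ hd hD₀
      set g : GL (Fin 2) L := γ (Projectivization.mk L w hw) with hgdef
      set σ : L := (D₀ * (S : Matrix (Fin 2) (Fin 2) L) * ((g : Matrix (Fin 2) (Fin 2) L))⁻¹) 1 1 with hσdef
      refine ⟨σ, u, w, hw, fun _ _ => ⟨hS1, fun k => ?_, ?_, ?_⟩⟩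
      · -- (ii) the corner equation + Levi relation read on the diagonal: `T_L X = (c g)ᵀ (T_L single 1 1 σ) g`
        have hginv : ((g : Matrix (Fin 2) (Fin 2) L))⁻¹ * (g : Matrix (Fin 2) (Fin 2) L) = 1 :=
          Matrix.nonsing_inv_mul _ ((Matrix.isUnit_iff_isUnit_det _).1 (Units.isUnit g))
        have hDX : D₀ * (S : Matrix (Fin 2) (Fin 2) L) = Matrix.single 1 1 σ * (g : Matrix (Fin 2) (Fin 2) L) := by
          have := congrArg (fun A => A * (g : Matrix (Fin 2) (Fin 2) L)) hsingle
          simpa only [Matrix.mul_assoc, hginv, Matrix.mul_one] using this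
        have hTX : (gramR L e dV hdV dW hdW).map (algebraMap (Fp L) L) * (S : Matrix (Fin 2) (Fin 2) L) =
            ((g : Matrix (Fin 2) (Fin 2) L).map ((IsCMField.complexConj L : L ≃ₐ[Fp L] L) : L →+* L))ᵀ *
              ((gramR L e dV hdV dW hdW).map (algebraMap (Fp L) L) * Matrix.single 1 1 σ) * (g : Matrix (Fin 2) (Fin 2) L) := by
          calc (gramR L e dV hdV dW hdW).map (algebraMap (Fp L) L) * (S : Matrix (Fin 2) (Fin 2) L)
              = (((g : Matrix (Fin 2) (Fin 2) L).map ((IsCMField.complexConj L : L ≃ₐ[Fp L] L) : L →+* L))ᵀ * (gramR L e dV hdV dW hdW).map (algebraMap (Fp L) L) * D₀) *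
                  (S : Matrix (Fin 2) (Fin 2) L) := by rw [hrel]
            _ = ((g : Matrix (Fin 2) (Fin 2) L).map ((IsCMField.complexConj L : L ≃ₐ[Fp L] L) : L →+* L))ᵀ * (gramR L e dV hdV dW hdW).map (algebraMap (Fp L) L) *
                  (D₀ * (S : Matrix (Fin 2) (Fin 2) L)) := by simp only [Matrix.mul_assoc]
            _ = _ := by rw [hDX]; simp only [Matrix.mul_assoc]
        have h := congrFun (congrFun hTX k) k
        rw [gramRL_mul_apply] at h
        rw [h]
        exact conj_single_apply_same L e dV hdV dW hdW σ _ k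
      · -- (iii) `τ(σ) ≠ 0`: `σ = δ · val₂ S · N(t)`
        obtain ⟨t, ht0, hσt⟩ := corner_eq_val₂_mul_norm L e dV hdV hdV0 dW hdW hdW0 (imagUnit_ne_zero L) (complexConj_imagUnit L) S.2 hr.1 hr.2 g hrel hsingle
        exact mul_trace_mul_imagUnit_ne_zero L (hval₂ L e dV hdV hdV0 dW hdW hdW0 (imagUnit_ne_zero L) (complexConj_imagUnit L) _ S.2 hr.1 hr.2) ht0 hσt
          (gramR_apply_same_ne_zero L e dV hdV hdV0 dW hdW hdW0 1)
      · -- (iv) the transport identity for every Haar `νN` and every Siegel section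
        intro νN _ χ s f hf h
        rw [hσdef, ← hsingle]
        exact whittakerDelta_eq_whittakerDelta_conj_index Λ hΛ hdV0 hdW0 νN hf g (measurePreserving_conj_levi Λ hΛ hdV0 hdW0 νN _)
          (Matrix.isUnits_det_units _) ha hd _ h
    · exact ⟨0, 0, ![1, 0], by simp, fun h0 hd => absurd ⟨h0, hd⟩ hr⟩
  choose σc u w hw hk using key
  exact ⟨σc, u, w, hw, hk⟩

end Summit.HodgeConjecture.HodgeConjecture.Cruxes.HLiu418.K2LiuKindOneSingularCornerPresentation

end
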